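/-
Copyright (c) 2026 the pub-hodgecm-mathlib formalisation cell (harness21).  Prover seat hodgecm-mathlib-K2E3-p17 (g6), Track B «K2-LIT» ∕ h413
(`stmt-HodgeConjecture-24833`), line `K2_E3_EllipticInputs`, unit U12 §L, Richardson road for (LBGL-ge3) at `N = 3` (road owner K2E3-p11),
brick (F-J) = (S-B♭)_Lie, FILE H1c «THE LOCAL DENSITY OF THE SPLIT ORBITAL MEASURE AT A REGULAR DIAGONAL POINT».  2026-09-04.
-/
import Summits.HodgeConjecture.HodgeConjecture.Theorems.K2E3GL3SplitOrbitalChangeOfVariables  -- ★ (this seat, H1b): `d = (d₀+z)∘σ`, involution identity, support lemma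
import Summits.HodgeConjecture.HodgeConjecture.Theorems.K2E3GL3KNOrbitalLocalPullback          -- ★ p857756 (this seat, G2): the `K × N₃` pullback, uniform in the Weyl translate
import Summits.HodgeConjecture.HodgeConjecture.Theorems.K2E3GL3DiagonalLevelProductMeasure      -- ★ p857738 (this seat, F2b): the level-`k` product formula (IMF)
import HarnessLib

/-!
# K2_E3 road (h413), §L ∕ Richardson road at `N = 3`, brick (F-J) FILE H1c: near `diag d₀` (regular) the split orbital measure
# `ρ(h) = ∫_{F³} ‖Δ(d)‖ ∫_{K×N₃} h(Ad(kn) diag d)` has density `c′ · (√‖disc χ‖)⁻¹` against `μ𝔤`, with `c′` INDEPENDENT of `d₀`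

Cell `pub/hodgecm-mathlib` (D-0151), Track B, seat K2E3-p17 (g6), deal (D60) = (F-J) (road owner K2E3-p11).  `--supports stmt-HodgeConjecture-24833 --as helper`;
THEOREMS ONLY (no definition ∕ instance ∕ notation ∕ named fact ∕ `sorry`); never imports `Cruxes/…/Lines`.  COUNT-NEUTRAL.

THE RESULT (**`exists_local_density`**).  `K = GL₃(𝒪)`, `N₃` upper unitriangular, Haar `κ`, `μN`; additive Haar `μ𝔤` on `M₃(F)`, `dx` on `F`.  There is `c′ ∈ (0,∞)`
(`c′ = 6 · μN(N₃(𝒪)) · c_IMF`) such that EVERY regular diagonal point `diag d₀` has an open neighbourhood `V` (a chart image of ★ E2) made of conjugates of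
regular diagonal matrices, with, for all Borel `h ≥ 0`,
  `∫_{F³} ‖Δ(d)‖ · ∫_{K×N₃} (1_V h)(Ad(k n) diag d) d(κ⊗μN) d(dx^{⊗3}) = c′ · ∫_V h · (√‖disc χ‖)⁻¹ dμ𝔤`.
PROOF = ★ H1b (only `d = (d₀ + z) ∘ σ` contribute; six disjoint box images; change of variables) + ★ H1a (`ẇ_σ ∈ K` turns `diag((d₀+z)∘σ)` into a Weyl
translate; `‖Δ‖` is constant `= ‖Δ(d₀)‖` there) + ★ G2 (the `K × N₃` pullback, uniform in `ẇ_σ`, given (IMF) ★ F2b) + ★ H1b involution (`∫_z ∫_X G(X⁺+X⁻+diag z)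
= dx(𝔭^k)³ ∫ G`) + ★ E2 (`∫_{box} h∘Ψ = ‖Δ(d₀)‖⁻² ∫_V h`) + `√‖disc χ‖ = ‖Δ(d₀)‖` on `V`.
[HarishChandra1999AdmissibleDistributions, Lemma 7.8, Thm. 7.7] [HarishChandra1970, Part I §5, Part V §4 Lemma 22] [WeilBNT1967, Ch. I §2]
HONEST LABEL: HC_CM is proved only modulo the 7 printed citations (2 remaining named inputs: hLiu418 = stmt-HodgeConjecture-24832, h413 = stmt-HodgeConjecture-24833)
until rung 0 closes; count-neutral helper.

## References
* [HarishChandra1999AdmissibleDistributions] Harish-Chandra (DeBacker–Sally), *Admissible Invariant Distributions on Reductive p-adic Groups* (1999), §7.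
* [HarishChandra1970] Harish-Chandra (van Dijk), *Harmonic Analysis on Reductive p-adic Groups*, LNM 162 (1970), Part I §5, Part V §4.
* [WeilBNT1967] A. Weil, *Basic Number Theory* (1967), Ch. I §2.
-/

set_option autoImplicit false
set_option linter.dupNamespace false

noncomputable section

open MeasureTheory Measure Filter Topology Set Matrix ValuativeRel
open scoped MatrixGroups NNReal ENNReal Valued
open Literature.NumberTheory.Automorphic Literature.NumberTheory.Automorphic.LocalFieldHaar
open Literature.NumberTheory.GaloisRepresentations Literature.NumberTheory.GaloisRepresentations.IsNonarchimedeanLocalField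
open Summit.HodgeConjecture.HodgeConjecture.Cruxes.H413.K2E3GL3OrbitChartDeriv
open Summit.HodgeConjecture.HodgeConjecture.Cruxes.H413.K2E3GL3OrbitChartStabilisers
open Summit.HodgeConjecture.HodgeConjecture.Cruxes.H413.K2E3GL3RegularDiagonalOrbitChart
open Summit.HodgeConjecture.HodgeConjecture.Cruxes.H413.K2E3GL3SplitTorusWeylKit
open Summit.HodgeConjecture.HodgeConjecture.Cruxes.H413.K2E3GL3SplitOrbitalChangeOfVariables
open Summit.HodgeConjecture.HodgeConjecture.Cruxes.H413.K2E3GL3KNOrbitalLocalPullback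
open Summit.HodgeConjecture.HodgeConjecture.Cruxes.H413.K2E3GL3DiagonalLevelProductMeasure

namespace Summit.HodgeConjecture.HodgeConjecture.Cruxes.H413.K2E3GL3OrbitalMeasureLocalDensity

variable {F : Type*} [Field F] [ValuativeRel F] [TopologicalSpace F] [IsNonarchimedeanLocalField F]

/-! ## §1  Small facts -/

omit [ValuativeRel F] [TopologicalSpace F] [IsNonarchimedeanLocalField F] in
/-- `Δ(d) ≠ 0 ⇒ d` injective. [folklore] -/
theorem injective_of_delta_ne_zero {d : Fin 3 → F} (h : (d 0 - d 1) * (d 0 - d 2) * (d 1 - d 2) ≠ 0) : Function.Injective d := by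
  intro i j hij
  by_contra hne
  apply h
  fin_cases i <;> fin_cases j <;> simp_all [sub_eq_zero]

/-- **A separating level exists**: `∃ k₂, ∀ k ≥ k₂, q^{-k} < ‖d_i − d_j‖` (`i ≠ j`, `d` injective). [folklore] -/
theorem exists_separating_level {d : Fin 3 → F} (hd : Function.Injective d) :
    ∃ k₂ : ℕ, ∀ k : ℕ, k₂ ≤ k → ∀ i j, i ≠ j → ((residueFieldCard F : ℝ≥0)⁻¹) ^ (k : ℤ) < normAbs F (d i - d j) := by
  have hlt := NNReal.tendsto_pow_atTop_nhds_zero_of_lt_one (inv_residueFieldCard_lt_one (F := F))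
  have hev : ∀ᶠ n : ℕ in atTop, ∀ p : Fin 3 × Fin 3, p.1 ≠ p.2 → ((residueFieldCard F : ℝ≥0)⁻¹) ^ n < normAbs F (d p.1 - d p.2) := by
    refine Filter.eventually_all.2 fun p => ?_
    by_cases hp : p.1 = p.2
    · exact Filter.Eventually.of_forall fun n h => absurd hp h
    · have hpos : 0 < normAbs F (d p.1 - d p.2) := by
        rw [pos_iff_ne_zero, ne_eq, map_eq_zero, sub_eq_zero]; exact fun h => hp (hd h)
      exact (hlt.eventually (gt_mem_nhds hpos)).mono fun n hn _ => hn
  obtain ⟨k₂, hk₂⟩ := Filter.eventually_atTop.1 hev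
  exact ⟨k₂, fun k hk i j hij => by rw [zpow_natCast]; exact hk₂ k hk (i, j) hij⟩

/-! ## §2  The local density -/

section Density

variable [MeasurableSpace F] [BorelSpace F] [MeasurableSpace (GL (Fin 3) F)] [BorelSpace (GL (Fin 3) F)]
  [MeasurableSpace (Matrix (Fin 3) (Fin 3) F)] [BorelSpace (Matrix (Fin 3) (Fin 3) F)]

/-- **THE LOCAL DENSITY OF THE SPLIT ORBITAL MEASURE** (see the module docstring).
[cite: HarishChandra1999AdmissibleDistributions, Lemma 7.8, Thm. 7.7] [cite: HarishChandra1970, Part V §4 Lemma 22] [cite: WeilBNT1967, Ch. I §2] -/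
theorem exists_local_density (κ : Measure ↥(glInt 3 F)) [IsHaarMeasure κ]
    (μN : Measure ↥(unipotentRadicalGL F (id : Fin 3 → Fin 3))) [IsHaarMeasure μN]
    (μ𝔤 : Measure (Matrix (Fin 3) (Fin 3) F)) [μ𝔤.IsAddHaarMeasure] (dx : Measure F) [dx.IsAddHaarMeasure] :
    ∃ c' : ℝ≥0∞, c' ≠ 0 ∧ c' ≠ ⊤ ∧ ∀ d₀ : Fin 3 → F, Function.Injective d₀ →
      ∃ V : Set (Matrix (Fin 3) (Fin 3) F), IsOpen V ∧ Matrix.diagonal d₀ ∈ V ∧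
        (∀ Y ∈ V, ∃ (g : GL (Fin 3) F) (e : Fin 3 → F), Function.Injective e ∧
          Y = (g : Matrix (Fin 3) (Fin 3) F) * Matrix.diagonal e * ((g⁻¹ : GL (Fin 3) F) : Matrix (Fin 3) (Fin 3) F)) ∧
        ∀ h : Matrix (Fin 3) (Fin 3) F → ℝ≥0∞, Measurable h →
          ∫⁻ d : Fin 3 → F, (normAbs F ((d 0 - d 1) * (d 0 - d 2) * (d 1 - d 2)) : ℝ≥0∞) *
              ∫⁻ q : ↥(glInt 3 F) × ↥(unipotentRadicalGL F (id : Fin 3 → Fin 3)),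
                V.indicator h ((((q.1 : GL (Fin 3) F) * (q.2 : GL (Fin 3) F) : GL (Fin 3) F) : Matrix (Fin 3) (Fin 3) F) * Matrix.diagonal d *
                  ((((q.1 : GL (Fin 3) F) * (q.2 : GL (Fin 3) F))⁻¹ : GL (Fin 3) F) : Matrix (Fin 3) (Fin 3) F)) ∂(κ.prod μN)
            ∂(Measure.pi fun _ : Fin 3 => dx) =
          c' * ∫⁻ Y in V, h Y * (((NNReal.sqrt (normAbs F Y.charpoly.discr))⁻¹ : ℝ≥0) : ℝ≥0∞) ∂μ𝔤 := by
  classical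
  haveI : T2Space F := (isLocalField F).toT2Space
  haveI : LocallyCompactSpace F := (isLocalField F).toLocallyCompactSpace
  haveI : SecondCountableTopology F := secondCountableTopology_localField F
  haveI : IsTopologicalRing F := inferInstance
  haveI : T2Space (GL (Fin 3) F) := t2Space_generalLinearGroup F 3
  haveI : SecondCountableTopology (Matrix (Fin 3) (Fin 3) F) := inferInstanceAs (SecondCountableTopology (Fin 3 → Fin 3 → F))
  haveI : LocallyCompactSpace (Matrix (Fin 3) (Fin 3) F) := Pi.locallyCompactSpace_of_finite
  haveI : BorelSpace ↥(unipotentRadicalGL F (id : Fin 3 → Fin 3)) := Subtype.borelSpace _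
  haveI : SFinite dx := inferInstance
  -- the constants
  obtain ⟨c, hc0, hct, k₁, hIMF⟩ := exists_lintegral_offDiagLevel_eq κ μ𝔤 dx
  set S : Set ↥(unipotentRadicalGL F (id : Fin 3 → Fin 3)) := {n | (n : GL (Fin 3) F) ∈ glInt 3 F} with hS
  have hSopen : IsOpen S := (isOpen_glInt 3 F).preimage continuous_subtype_val
  have hS0 : μN S ≠ 0 := (hSopen.measure_pos μN ⟨1, show ((1 : ↥(unipotentRadicalGL F (id : Fin 3 → Fin 3))) : GL (Fin 3) F) ∈ glInt 3 F from one_mem _⟩).ne'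
  have hSt : μN S ≠ ⊤ := by
    have hcl : IsClosed (unipotentRadicalGL F (id : Fin 3 → Fin 3) : Set (GL (Fin 3) F)) := isClosed_unipotentRadicalGL (R := F) (id : Fin 3 → Fin 3)
    have hcpt : IsCompact S := hcl.isClosedEmbedding_subtypeVal.isCompact_preimage (isCompact_glInt (n := 3) (F := F))
    exact hcpt.measure_lt_top.ne
  have hball0 : ∀ k : ℕ, dx (primePowBall F k) ≠ 0 := fun k =>
    ((isOpen_primePowBall (F := F) k).measure_pos dx ⟨0, zero_mem_primePowBall _⟩).ne'
  have hballt : ∀ k : ℕ, dx (primePowBall F k) ≠ ⊤ := fun k => (isCompact_primePowBall (F := F) k).measure_lt_top.ne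
  refine ⟨6 * μN S * c, mul_ne_zero (mul_ne_zero (by norm_num) hS0) hc0,
    ENNReal.mul_ne_top (ENNReal.mul_ne_top (by norm_num) hSt) hct, fun d₀ hd₀ => ?_⟩
  -- the chart at `diag d₀` and the level `k`
  have hd₀' : ∀ i j, i ≠ j → d₀ i ≠ d₀ j := fun i j hij h => hij (hd₀ h)
  obtain ⟨k₂, hk₂⟩ := exists_separating_level hd₀
  set Ψ : Matrix (Fin 3) (Fin 3) F → Matrix (Fin 3) (Fin 3) F := fun X : Matrix (Fin 3) (Fin 3) F =>
    (1 + !![0, X 0 1, X 0 2; 0, 0, X 1 2; 0, 0, 0]) * (1 + !![0, 0, 0; X 1 0, 0, 0; X 2 0, X 2 1, 0]) *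
      (Matrix.diagonal d₀ + Matrix.diagonal (fun i => X i i)) *
      ((1 - !![0, 0, 0; X 1 0, 0, 0; X 2 0, X 2 1, 0] + !![0, 0, 0; X 1 0, 0, 0; X 2 0, X 2 1, 0] * !![0, 0, 0; X 1 0, 0, 0; X 2 0, X 2 1, 0]) *
        (1 - !![0, X 0 1, X 0 2; 0, 0, X 1 2; 0, 0, 0] + !![0, X 0 1, X 0 2; 0, 0, X 1 2; 0, 0, 0] * !![0, X 0 1, X 0 2; 0, 0, X 1 2; 0, 0, 0])) with hΨ
  obtain ⟨k₀, hk₀⟩ := exists_depth_orbitChart d₀ hd₀' μ𝔤 Ψ hΨ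
  set k : ℕ := max k₀ (max k₁ k₂) with hk
  obtain ⟨-, hVopen, -, hdV, hchart⟩ := hk₀ k (le_max_left _ _)
  have hsep := hk₂ k ((le_max_right _ _).trans (le_max_right _ _))
  have hIMFk := hIMF k ((le_max_left _ _).trans (le_max_right _ _))
  set Box : Set (Matrix (Fin 3) (Fin 3) F) := {X : Matrix (Fin 3) (Fin 3) F | ∀ i j, X i j ∈ primePowBall F k} with hBox
  set bz : Set (Fin 3 → F) := {z : Fin 3 → F | ∀ i, z i ∈ primePowBall F k} with hbz
  set V : Set (Matrix (Fin 3) (Fin 3) F) := Ψ '' Box with hV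
  have hV_m : MeasurableSet V := hVopen.measurableSet
  have hBox_m : MeasurableSet Box := (Literature.MeasureTheory.Group.isOpen_setOf_forall_mem_primePowBall (F := F) (n := Fin 3) k).measurableSet
  have hbz_m : MeasurableSet bz := by
    have : bz = Set.pi univ fun _ => (primePowBall F k : Set F) := by ext z; simp only [hbz, Set.mem_setOf_eq, Set.mem_univ_pi]
    rw [this]; exact MeasurableSet.univ_pi fun _ => measurableSet_primePowBall k
  have hΨc : Continuous Ψ := by rw [hΨ]; exact continuous_orbitChart d₀
  -- elements of `V`
  have hVel : ∀ Y ∈ V, ∃ (g : GL (Fin 3) F) (X : Matrix (Fin 3) (Fin 3) F), X ∈ Box ∧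
      Y = (g : Matrix (Fin 3) (Fin 3) F) * Matrix.diagonal (d₀ + fun i => X i i) * ((g⁻¹ : GL (Fin 3) F) : Matrix (Fin 3) (Fin 3) F) := by
    rintro Y ⟨X, hX, rfl⟩
    obtain ⟨g, -, hg⟩ := exists_orbitChart_eq_conj d₀ X
    exact ⟨g, X, hX, by rw [hΨ]; exact hg⟩
  set δ : ℝ≥0 := normAbs F ((d₀ 0 - d₀ 1) * (d₀ 0 - d₀ 2) * (d₀ 1 - d₀ 2)) with hδ
  have hδ0 : δ ≠ 0 := by rw [hδ, ne_eq, map_eq_zero]; exact delta_ne_zero hd₀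
  refine ⟨V, hVopen, hdV, fun Y hY => ?_, fun h hh => ?_⟩
  · obtain ⟨g, X, hX, rfl⟩ := hVel Y hY
    exact ⟨g, _, injective_add_of_sep hsep (fun i => hX i i), rfl⟩
  -- ===== the identity =====
  have hVh : Measurable (V.indicator h) := hh.indicator hV_m
  -- Weyl data: the translations `T_σ` and the permutation matrices `ẇ_σ`
  have hT := fun σ : Equiv.Perm (Fin 3) => exists_measurableEquiv_perm_add dx d₀ σ
  choose T hT hTp using hT
  have hm := fun σ : Equiv.Perm (Fin 3) => exists_permGL_mem_glInt (F := F) σ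
  choose m hmK hmA hmdiag using hm
  set A : Equiv.Perm (Fin 3) → Set (Fin 3 → F) := fun σ => (fun z : Fin 3 → F => (d₀ + z) ∘ σ) '' bz with hA
  have hTfun : ∀ σ, ((T σ : (Fin 3 → F) ≃ᵐ (Fin 3 → F)) : (Fin 3 → F) → (Fin 3 → F)) = fun z => (d₀ + z) ∘ σ := fun σ => funext (hT σ)
  have hA_m : ∀ σ, MeasurableSet (A σ) := fun σ => by
    rw [hA]; simp only; rw [← hTfun σ]; exact (T σ).measurableEmbedding.measurableSet_image.2 hbz_m
  -- the integrand and its support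
  set O : (Fin 3 → F) → ℝ≥0∞ := fun d => ∫⁻ q : ↥(glInt 3 F) × ↥(unipotentRadicalGL F (id : Fin 3 → Fin 3)),
      V.indicator h ((((q.1 : GL (Fin 3) F) * (q.2 : GL (Fin 3) F) : GL (Fin 3) F) : Matrix (Fin 3) (Fin 3) F) * Matrix.diagonal d *
        ((((q.1 : GL (Fin 3) F) * (q.2 : GL (Fin 3) F))⁻¹ : GL (Fin 3) F) : Matrix (Fin 3) (Fin 3) F)) ∂(κ.prod μN) with hO
  set f : (Fin 3 → F) → ℝ≥0∞ := fun d => (normAbs F ((d 0 - d 1) * (d 0 - d 2) * (d 1 - d 2)) : ℝ≥0∞) * O d with hf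
  set U : Set (Fin 3 → F) := ⋃ σ ∈ (Finset.univ : Finset (Equiv.Perm (Fin 3))), A σ with hU
  have hU_m : MeasurableSet U := MeasurableSet.biUnion (Finset.univ : Finset (Equiv.Perm (Fin 3))).countable_toSet fun σ _ => hA_m σ
  have hfU : ∀ d, d ∉ U → f d = 0 := by
    intro d hdU
    by_cases hΔ : (d 0 - d 1) * (d 0 - d 2) * (d 1 - d 2) = 0
    · simp only [hf, hΔ, map_zero, ENNReal.coe_zero, zero_mul]
    have hdinj := injective_of_delta_ne_zero hΔ
    have hnot : ∀ (σ : Equiv.Perm (Fin 3)) (z : Fin 3 → F), (∀ i, z i ∈ primePowBall F k) → d ≠ (d₀ + z) ∘ σ := by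
      intro σ z hz hdz
      exact hdU (Set.mem_iUnion₂.2 ⟨σ, Finset.mem_univ σ, ⟨z, hz, hdz.symm⟩⟩)
    have hO0 : O d = 0 := by
      simp only [hO]
      refine (lintegral_congr fun q => ?_).trans lintegral_zero
      exact Set.indicator_of_notMem (conj_diagonal_notMem_image_orbitChart d₀ Ψ hΨ hdinj hnot _) _
    simp only [hf, hO0, mul_zero]
  have hstep1 : ∫⁻ d, f d ∂(Measure.pi fun _ : Fin 3 => dx) = ∑ σ : Equiv.Perm (Fin 3), ∫⁻ d in A σ, f d ∂(Measure.pi fun _ : Fin 3 => dx) := by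
    rw [← lintegral_biUnion_finset (fun σ _ τ _ hστ => disjoint_image_perm_add hsep hστ) (fun σ _ => hA_m σ), ← hU, ← lintegral_indicator hU_m]
    refine lintegral_congr fun d => ?_
    by_cases hd : d ∈ U
    · rw [Set.indicator_of_mem hd]
    · rw [Set.indicator_of_notMem hd, hfU d hd]
  -- each Weyl term
  set I : (Fin 3 → F) → ℝ≥0∞ := fun z => ∫⁻ X in Box, h (Ψ ((!![0, X 0 1, X 0 2; 0, 0, X 1 2; 0, 0, 0] : Matrix (Fin 3) (Fin 3) F) +
    !![0, 0, 0; X 1 0, 0, 0; X 2 0, X 2 1, 0] + Matrix.diagonal z)) ∂μ𝔤 with hI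
  have hpt : ∀ (σ : Equiv.Perm (Fin 3)) (z : Fin 3 → F), z ∈ bz →
      f ((d₀ + z) ∘ σ) = (δ : ℝ≥0∞) * ((dx (primePowBall F k) ^ 3)⁻¹ * (μN S * (c * I z))) := by
    intro σ z hz
    have hz' : ∀ i, z i ∈ primePowBall F k := hz
    have hG2 := lintegral_prod_indicator_image_orbitChart_eq κ μN μ𝔤 dx d₀ hsep Ψ hΨ hz' (m σ) (hmK σ) (hmA σ) hIMFk h hh
    have hOeq : O ((d₀ + z) ∘ σ) = ∫⁻ q : ↥(glInt 3 F) × ↥(unipotentRadicalGL F (id : Fin 3 → Fin 3)),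
        V.indicator h ((((q.1 : GL (Fin 3) F) * (q.2 : GL (Fin 3) F) * m σ : GL (Fin 3) F) : Matrix (Fin 3) (Fin 3) F) * Matrix.diagonal (d₀ + z) *
          ((((q.1 : GL (Fin 3) F) * (q.2 : GL (Fin 3) F) * m σ)⁻¹ : GL (Fin 3) F) : Matrix (Fin 3) (Fin 3) F)) ∂(κ.prod μN) := by
      simp only [hO]
      refine lintegral_congr fun q => ?_
      rw [← hmdiag σ (d₀ + z), Units.val_mul ((q.1 : GL (Fin 3) F) * (q.2 : GL (Fin 3) F)) (m σ),
        _root_.mul_inv_rev ((q.1 : GL (Fin 3) F) * (q.2 : GL (Fin 3) F)) (m σ), Units.val_mul ((m σ)⁻¹) (((q.1 : GL (Fin 3) F) * (q.2 : GL (Fin 3) F))⁻¹)]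
      simp only [Matrix.mul_assoc]
    have hO' : O ((d₀ + z) ∘ σ) = (dx (primePowBall F k) ^ 3)⁻¹ * (μN S * (c * I z)) := by
      rw [hOeq, ← hG2, ← mul_assoc, ENNReal.inv_mul_cancel (pow_ne_zero 3 (hball0 k)) (ENNReal.pow_ne_top (hballt k)), one_mul]
    simp only [hf]
    rw [hO', normAbs_delta_perm (d₀ + z) σ, normAbs_delta_add_eq hsep hz']
  have hconst_t : (δ : ℝ≥0∞) * ((dx (primePowBall F k) ^ 3)⁻¹ * (μN S * c)) ≠ ⊤ :=
    ENNReal.mul_ne_top ENNReal.coe_ne_top (ENNReal.mul_ne_top (ENNReal.inv_ne_top.2 (pow_ne_zero 3 (hball0 k))) (ENNReal.mul_ne_top hSt hct))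
  have hstep2 : ∀ σ : Equiv.Perm (Fin 3), ∫⁻ d in A σ, f d ∂(Measure.pi fun _ : Fin 3 => dx) =
      (δ : ℝ≥0∞) * ((dx (primePowBall F k) ^ 3)⁻¹ * (μN S * c)) * ∫⁻ z in bz, I z ∂(Measure.pi fun _ : Fin 3 => dx) := by
    intro σ
    have h1 := (hTp σ).setLIntegral_comp_emb (T σ).measurableEmbedding f bz
    rw [hTfun σ] at h1
    rw [hA]; simp only
    rw [← h1, ← lintegral_const_mul' _ _ hconst_t]
    refine setLIntegral_congr_fun hbz_m (fun z hz => ?_)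
    rw [hpt σ z hz]; ring
  -- the involution and the chart
  have hstep3 : ∫⁻ z in bz, I z ∂(Measure.pi fun _ : Fin 3 => dx) = dx (primePowBall F k) ^ 3 * ∫⁻ X in Box, h (Ψ X) ∂μ𝔤 :=
    setLIntegral_box_offDiag_add_diagonal_eq dx μ𝔤 (k : ℤ) (fun X => h (Ψ X)) (hh.comp hΨc.measurable)
  have hstep4 : ∫⁻ X in Box, h (Ψ X) ∂μ𝔤 = (((δ ^ 2)⁻¹ : ℝ≥0) : ℝ≥0∞) * ∫⁻ Y in V, h Y ∂μ𝔤 := by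
    rw [hchart h hh, normAbs_prod_prod_ite_eq]
  -- the weight on `V`
  have hstep5 : ∫⁻ Y in V, h Y * (((NNReal.sqrt (normAbs F Y.charpoly.discr))⁻¹ : ℝ≥0) : ℝ≥0∞) ∂μ𝔤 = (∫⁻ Y in V, h Y ∂μ𝔤) * ((δ⁻¹ : ℝ≥0) : ℝ≥0∞) := by
    rw [← lintegral_mul_const' _ _ ENNReal.coe_ne_top]
    refine setLIntegral_congr_fun hV_m (fun Y hY => ?_)
    obtain ⟨g, X, hX, rfl⟩ := hVel Y hY
    rw [sqrt_normAbs_discr_charpoly_conj_diagonal, normAbs_delta_add_eq hsep (fun i => hX i i)]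
  -- assemble
  rw [hstep1, Finset.sum_congr rfl (fun σ _ => hstep2 σ), Finset.sum_const, Finset.card_univ, Fintype.card_perm, Fintype.card_fin, hstep3, hstep4, hstep5]
  have h6 : Nat.factorial 3 = 6 := rfl
  rw [h6]
  have hδδ : ((δ : ℝ≥0∞)) * (((δ ^ 2)⁻¹ : ℝ≥0) : ℝ≥0∞) = ((δ⁻¹ : ℝ≥0) : ℝ≥0∞) := by
    rw [← ENNReal.coe_mul]; congr 1
    rw [pow_two, mul_inv, ← mul_assoc, mul_inv_cancel₀ hδ0, one_mul]
  have hdx : (dx (primePowBall F k) ^ 3)⁻¹ * dx (primePowBall F k) ^ 3 = 1 :=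
    ENNReal.inv_mul_cancel (pow_ne_zero 3 (hball0 k)) (ENNReal.pow_ne_top (hballt k))
  set J := ∫⁻ Y in V, h Y ∂μ𝔤
  set B := dx (primePowBall F k) ^ 3 with hB
  calc (6 : ℕ) • ((δ : ℝ≥0∞) * (B⁻¹ * (μN S * c)) * (B * ((((δ ^ 2)⁻¹ : ℝ≥0) : ℝ≥0∞) * J)))
      = 6 * (μN S * c * J) * ((B⁻¹ * B) * ((δ : ℝ≥0∞) * (((δ ^ 2)⁻¹ : ℝ≥0) : ℝ≥0∞))) := by rw [nsmul_eq_mul]; push_cast; ring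
    _ = 6 * μN S * c * (J * ((δ⁻¹ : ℝ≥0) : ℝ≥0∞)) := by rw [hdx, hδδ, one_mul]; ring

end Density

end Summit.HodgeConjecture.HodgeConjecture.Cruxes.H413.K2E3GL3OrbitalMeasureLocalDensity

end
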